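import Summits.Schanuel.Schanuel.Theorems.ZilberEacPuiseuxBranches
import Summits.Schanuel.Schanuel.Theorems.ZilberEacGraphCycleBranch
import Summits.Schanuel.Schanuel.Theorems.ZilberEacGraphResidualSimpleRoots
import HarnessLib

/-!
# The equimodular class, LXXIII: MANTOVA–MASSER'S DENSITY QUESTION DECIDED OVER EVERY POLYNOMIAL
# GRAPH OF DEGREE ≥ 2 — every fibre curve is dense; the only non-dense surfaces are constant fibres

HONEST FRAMING.  Cell `pub-schanuel` (Zilber's Exponential-Algebraic Closedness, case ladder;
host summit Schanuel), seat 2, gen 26.  Mantova–Masser (PLMS 2024, §1 p. 5) ask whether the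
UNPROJECTED exponential points of a surface `W ⊆ ℂ² × (ℂˣ)²` of their case (dim-π-S-1-free) are
Zariski dense in `W`.  Gens 3–26 of this cell decided it for larger and larger classes of surfaces
whose additive projection is a polynomial graph `x₁ = p(x₀)`, `deg p ≥ 2`.  This file closes that
chapter:
* **`unprojectedDense_graph_fibreCurve`** — `P ∈ ℂ[x₀, y₀]` irreducible with rows `Q = Σ q_j(s)t^j`
  of positive `t`-degree, whose top row `T` has a nonzero root and whose lowest row `q₀ ≠ 0` has a
  root: then `W = {x₁ = p(x₀), P(x₀, y₀) = 0}` has Zariski-dense exponential points.  Proof: the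
  Newton–Puiseux theorem (files LXVIII–LXXII) supplies a cycle of branches at infinity through the
  top-row root and a parametrised zero branch at the root of `q₀`; the master theorem of file LXVI
  (chart inversion, `k`-th-power labels, growth/resonance/Kronecker trichotomy, Liouville-type
  transcendence of the logarithm of an algebraic branch) does the rest.
* **`mmCase_graphBase_complete`** — THE ANSWER over polynomial graphs: if `W` is in Mantova–Masser's
  case with `cl π(W ∩ G²) = {x₁ = p(x₀)}`, `deg p ≥ 2`, and its exponential points are NOT Zariski
  dense, then `W = {x₁ = p(x₀)} × {P₂(y₀) = 0}` for an irreducible `P₂ ∈ ℂ[y₀]` — a CONSTANT FIBRE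
  `y₀ = θ` (which is indeed not dense in general: `{x₁ = x₀²/(2πi), y₀ = 1}`, seat 1 gen 9).
So, over polynomial graphs of degree `≥ 2`, the answer to Mantova–Masser's question is YES for every
surface except the constant-fibre cylinders.  What this is NOT: the question over other base curves
(lines of non-real slope are Mantova–Masser's own theorem; real irrational slope, polynomial curves:
earlier gens, partially), Fib(3,2), the open cell EC(3,2) of Zilber's conjecture — all OPEN; NOT
Schanuel's conjecture (neither used nor implied); EAC ⇏ SC.
-/

noncomputable section

open Filter Topology Set Complex MvPolynomial
open Literature.NumberTheory.Transcendental Literature.ModelTheory.Zilber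
open Literature.ModelTheory.ExponentialFields

set_option linter.dupNamespace false

namespace Summit.Schanuel.Schanuel.Theorems

/-! ## Part A. Every fibre curve over a polynomial graph is dense -/

/-- **Every fibre curve over a polynomial graph of degree `≥ 2` has Zariski-dense exponential
points.**  `P` irreducible with rows `Q` of positive `t`-degree and of degree `≤ N`; the top row `T`
has a nonzero root `θ`; the lowest row `q₀ ≠ 0` has a root `a`; `deg p ≥ 2`.
[cite: MantovaMasser2023, §1 Further remarks, p. 5 (the question, open in general)] (new) -/
theorem unprojectedDense_graph_fibreCurve (Q : Polynomial (Polynomial ℂ))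
    {P : MvPolynomial (Fin 2) ℂ}
    (hP : ∀ x y : ℂ, MvPolynomial.eval ![x, y] P = (Q.map (Polynomial.evalRingHom x)).eval y)
    (hirr : Irreducible P) (hQ1 : Q.natDegree ≠ 0) (N : ℕ) (hN : ∀ j, (Q.coeff j).natDegree ≤ N)
    (T : Polynomial ℂ) (hT : ∀ j, T.coeff j = (Q.coeff j).coeff N) (hT0 : T ≠ 0) {θ : ℂ} (hθ0 : θ ≠ 0)
    (hTθ : T.IsRoot θ) (hQ00 : Q.coeff 0 ≠ 0) {a : ℂ} (ha : (Q.coeff 0).IsRoot a)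
    (p : Polynomial ℂ) (hd : 2 ≤ p.natDegree) :
    UnprojectedDense {w : Fin 2 ⊕ Fin 2 → ℂ | w (Sum.inl 1) = p.eval (w (Sum.inl 0)) ∧
      MvPolynomial.eval ![w (Sum.inl 0), w (Sum.inr 0)] P = 0} := by
  have hQirr : Irreducible Q := (irreducible_rows_iff hP).1 hirr
  obtain ⟨k, ψ, hk, hψ, hψ0, hbranch⟩ := exists_fibreCycle_puiseux Q hQirr hQ1 N hN T hT hT0 hTθ
  obtain ⟨e, η, he, hηan, hη0, hηne, hQη⟩ := exists_zeroBranch_puiseux Q hQirr hQ1 hQ00 ha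
  exact unprojectedDense_graph_cycle_zeroBranch Q hP hirr hQ1 hk hψ hθ0 hψ0 hbranch
    (analyticAt_const.add (analyticAt_id.pow e)) hηan hη0 (deriv_newtonBase_ne_zero a he) hηne hQη p hd

/-! ## Part B. The answer over polynomial graphs -/

section Complete

variable (p : Polynomial ℂ)

/-- **Mantova–Masser's density question over polynomial graphs of degree `≥ 2`: the complete
answer.**  A surface of their case over `x₁ = p(x₀)` WITHOUT Zariski-dense exponential points is a
constant-fibre cylinder `{x₁ = p(x₀)} × {P₂(y₀) = 0}`, `P₂ ∈ ℂ[y₀]` irreducible.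
[cite: MantovaMasser2023, §1 Further remarks, p. 5 (the question, open in general)] (new) -/
theorem mmCase_graphBase_complete (hd : 2 ≤ p.natDegree)
    {W : Set (Fin 2 ⊕ Fin 2 → ℂ)} (hmm : MMCaseDimPiOneFree W)
    (hbase : zeroLocus ℂ (vanishingIdeal ℂ (projAdd '' (W ∩ torusLocus ℂ 2))) =
      {x : Fin 2 → ℂ | x 1 = p.eval (x 0)})
    (hnot : ¬ UnprojectedDense W) :
    ∃ P₂ : MvPolynomial (Fin 2) ℂ, Irreducible P₂ ∧
      W = {w : Fin 2 ⊕ Fin 2 → ℂ | w (Sum.inl 1) = p.eval (w (Sum.inl 0)) ∧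
        MvPolynomial.eval ![w (Sum.inl 0), w (Sum.inr 0)] P₂ = 0} ∧
      (∀ v ∈ P₂.support, v 0 = 0) := by
  classical
  obtain ⟨P₂, hirr₂, h1, hW₂, -, hrow, -, hdisj⟩ :=
    mmCase_graphBase_residual_simpleRoots p hd hmm hbase hnot
  refine ⟨P₂, hirr₂, hW₂, ?_⟩
  rcases hdisj with ⟨hpos, -⟩ | hconst
  swap
  · exact hconst
  by_contra hconst
  push Not at hconst
  -- the degrees `N₀` (in `x₀`) and `r` (in `y₀`)
  have hsupp : P₂.support.Nonempty := by
    rw [Finset.nonempty_iff_ne_empty, Ne, MvPolynomial.support_eq_empty]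
    exact hirr₂.ne_zero
  obtain ⟨v₀, hv₀, hv₀max⟩ := Finset.exists_max_image P₂.support (fun v : Fin 2 →₀ ℕ => v 0) hsupp
  obtain ⟨vr, hvr, hvrmax⟩ := Finset.exists_max_image P₂.support (fun v : Fin 2 →₀ ℕ => v 1) hsupp
  set N₀ := v₀ 0 with hN₀
  set r := vr 1 with hr
  have hN : ∀ v ∈ P₂.support, v 0 ≤ N₀ := hv₀max
  have hrle : ∀ v ∈ P₂.support, v 1 ≤ r := hvrmax
  -- the rows
  set Q : Polynomial (Polynomial ℂ) :=
    ∑ v ∈ P₂.support, Polynomial.monomial (v 1) (Polynomial.monomial (v 0) (P₂.coeff v)) with hQ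
  set T : Polynomial ℂ := ∑ v ∈ P₂.support.filter (fun v : Fin 2 →₀ ℕ => v 0 = N₀),
    Polynomial.C (P₂.coeff v) * Polynomial.X ^ (v 1) with hTdef
  have hPQ : ∀ x y : ℂ, MvPolynomial.eval ![x, y] P₂ = (Q.map (Polynomial.evalRingHom x)).eval y :=
    fun x y => eval_eq_rowsPP P₂ x y
  have hNQ : ∀ j, (Q.coeff j).natDegree ≤ N₀ := fun j => natDegree_coeff_rowsPP_le P₂ hN j
  have hQdeg : Q.natDegree = r := natDegree_rowsPP_eq P₂ hrle ⟨vr, hvr, rfl⟩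
  have hT : ∀ j, T.coeff j = (Q.coeff j).coeff N₀ := fun j => coeff_topRowSum_eq_coeff_coeff_rowsPP P₂ N₀ j
  have hTcoeff : ∀ j, T.coeff j = P₂.coeff (Finsupp.single 0 N₀ + Finsupp.single 1 j) :=
    fun j => coeff_topRowSum P₂ N₀ j
  -- the extreme monomials of the top row
  obtain ⟨⟨vR, hvR, hvR0, hvRmax⟩, ⟨vL, hvL, hvL0, hvLmin⟩⟩ := hrow v₀ hv₀ hN
  rw [← hN₀] at hvR0 hvL0
  have hvR1 : vR 1 = r := le_antisymm (hrle vR hvR) (hvRmax vr hvr)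
  obtain ⟨u, hu, hu1⟩ := exists_support_snd_eq_zero_of_irreducible P₂ hirr₂ h1
  have hvL1 : vL 1 = 0 := Nat.le_zero.1 (hu1 ▸ hvLmin u hu)
  have hTr : T.coeff r ≠ 0 := by
    rw [hTcoeff, ← hvR0, ← hvR1, ← Literature.NumberTheory.EllipticCurves.finsupp_fin_two_eq vR]
    exact MvPolynomial.mem_support_iff.1 hvR
  have hT0c : T.coeff 0 ≠ 0 := by
    rw [hTcoeff, ← hvL0, ← hvL1, ← Literature.NumberTheory.EllipticCurves.finsupp_fin_two_eq vL]
    exact MvPolynomial.mem_support_iff.1 hvL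
  have hT0 : T ≠ 0 := fun h => hTr (by rw [h, Polynomial.coeff_zero])
  -- `r ≥ 1`, `N₀ ≥ 1`
  have hr1 : 1 ≤ r := by
    obtain ⟨v, hv, v', hv', hvv'⟩ := h1
    have h1' := hrle v hv
    have h2' := hrle v' hv'
    omega
  have hN1 : 1 ≤ N₀ := by
    obtain ⟨v, hv, hv0⟩ := hconst
    have := hN v hv
    omega
  -- a nonzero root of `T` and a root of `q₀`
  have hTdeg' : 0 < T.degree := by
    have h : (r : WithBot ℕ) ≤ T.degree := Polynomial.le_degree_of_ne_zero hTr
    exact lt_of_lt_of_le (by exact_mod_cast hr1) h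
  obtain ⟨θ, hθ⟩ := Complex.exists_root hTdeg'
  have hθ0 : θ ≠ 0 := by
    rintro rfl
    apply hT0c
    rw [Polynomial.coeff_zero_eq_eval_zero]; exact hθ
  have hQ00 : Q.coeff 0 ≠ 0 := by
    intro h
    apply hT0c
    rw [hT, h, Polynomial.coeff_zero]
  have hq0deg : 0 < (Q.coeff 0).degree := by
    have h : (N₀ : WithBot ℕ) ≤ (Q.coeff 0).degree :=
      Polynomial.le_degree_of_ne_zero (by rw [← hT]; exact hT0c)
    exact lt_of_lt_of_le (by exact_mod_cast hN1) h
  obtain ⟨a, ha⟩ := Complex.exists_root hq0deg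
  have hQ1 : Q.natDegree ≠ 0 := by rw [hQdeg]; omega
  apply hnot
  rw [hW₂]
  exact unprojectedDense_graph_fibreCurve Q hPQ hirr₂ hQ1 N₀ hNQ T hT hT0 hθ0 hθ hQ00 ha p hd

end Complete

end Summit.Schanuel.Schanuel.Theorems
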